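import Summits.NavierStokesRegularity.NavierStokesRegularity.Theorems.ExtremiserTransienceNearExtremalTransienceExtremiserLiouvilleConstantSpeedMultiplierMeasure
import Summits.NavierStokesRegularity.NavierStokesRegularity.Theorems.ExtremiserTransienceNearExtremalTransienceExtremiserLiouvilleConstantSpeedKKTTail
import Summits.NavierStokesRegularity.NavierStokesRegularity.Theorems.ExtremiserTransienceNearExtremalTransienceExtremiserLiouvilleConstantSpeedGlobalVariation
import HarnessLib

/-!
# Crux `ExtremiserTransience.NearExtremalTransience` (stmt-NavierStokesRegularity-21883), line `extremiser_liouville`,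
# stub K1b — THE BLOW-DOWN PAIRING LAW: the residue's far field is the Stokeslet of its multiplier's barycentre

`--supports stmt-NavierStokesRegularity-21883` (helper).  Author: prover seat `ns-el-k1b` (g5).  Combines g3's multiplier
equation (`…ConstantSpeedMultiplierMeasure`: `S·J₁(φ) − κ⋆²M²(W a₁(φ) + Z c₁(φ)) = ∫⟪v, φ⟫dμ` for solenoidal `φ ∈ C_c^∞`,
`μ` finite) with g4's rescaling tools (`…ConstantSpeedKKTTail{,Tools}`).

* `tendsto_blowDown_pairing` : for `v` smooth with `‖v‖ ≡ M`, `D¹v, D²v ∈ L²`, ANY finite measure `μ` satisfying the multiplier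
  equation, and ANY smooth compactly supported divergence-free `Ψ`:
  **`κ⋆² M² W · a₁(Ψ(·/R)) ⟶ −∫ ⟪v x, Ψ(0)⟫ dμ(x) = −⟪b, Ψ(0)⟫`  as `R → ∞`**, `b = ∫ v dμ` the barycentre of the multiplier
  (`a₁(φ) = ∫⟪curl v, curl φ⟫`).  Mechanism: `|J₁(Ψ_R)| ≤ G/R`, `|c₁(Ψ_R)| ≤ (η/2)W + C/(ηR)` (g4's global-`L²` bounds) and
  `∫⟪v, Ψ(·/R)⟫dμ → ∫⟪v, Ψ(0)⟫dμ` by dominated convergence in the finite measure `μ`.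

READING (record `Lines/extremiser_liouville_k1b_jet.md` §6).  Since `a₁(Ψ_R) = −∫⟪V, ΔΨ_R⟫ = −∫⟪V_R, ΔΨ⟫` with `V = v − c` and the
degree-`(−1)` blow-down `V_R = R·V(R·)`, the law says: **in the sense of distributions modulo gradients,
`κ⋆²M²W·ΔV_R ⟶ b·δ₀`** — every blow-down limit of the residue object is the STOKESLET of force `b/(κ⋆²M²W)`.  g4's KKT tail
condition (`residue_tail_pairing_tendsto_zero`: limit `0` for `c`-horizontal `Ψ` vanishing near `0`) is the special case
`Ψ(0) = 0`.  For the residue JET (slab energies `≤ N·E₀`, `…SlabEnergySandwich`) `V_R` is bounded in `L²_loc` and horizontal in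
the limit (`V_ξ = −|V|²/2M`), while a horizontal Stokeslet vanishes: hence `b = 0` and `μ(ℝ³) = κ⋆²ZW` there (§6, next seat).

WHAT THIS IS NOT: K1b is NOT proved; nothing here proves NS regularity. [folklore]
-/

noncomputable section

open Set Filter Topology MeasureTheory Metric Function
open scoped ENNReal NNReal Topology InnerProductSpace RealInnerProductSpace ContDiff
open Literature.Analysis.FluidPDE Literature.Analysis

namespace Summit.NavierStokesRegularity.NavierStokesRegularity.Theorems

-- the problem directory repeats the summit name (`NavierStokesRegularity/NavierStokesRegularity`)
set_option linter.dupNamespace false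

namespace ExtremiserLiouville

open DepletionLadder.KStar DepletionLadder.KStar.HalfSpace
open Summit.NavierStokesRegularity.NavierStokesRegularity.Theorems.RungReynoldsOne.WeightedSlice

variable {v Ψ : E3 → E3}

/-! ## Dominated convergence on the multiplier side -/

/-- `∫ ⟪v x, Ψ(R⁻¹x)⟫ dμ(x) → ∫ ⟪v x, Ψ(0)⟫ dμ(x)` as `R → ∞` (`μ` finite, `v` bounded continuous, `Ψ` bounded continuous).
[folklore] -/
theorem tendsto_integral_inner_rescale (hvc : Continuous v) {M : ℝ} (hM : ∀ x, ‖v x‖ = M)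
    (hΨc : Continuous Ψ) {C : ℝ} (hC : ∀ y, ‖Ψ y‖ ≤ C) (μ : Measure E3) [IsFiniteMeasure μ] :
    Tendsto (fun R : ℝ => ∫ x, ⟪v x, Ψ (R⁻¹ • x)⟫_ℝ ∂μ) atTop (𝓝 (∫ x, ⟪v x, Ψ 0⟫_ℝ ∂μ)) := by
  have hmeas : ∀ᶠ R : ℝ in atTop,
      AEStronglyMeasurable (fun x : E3 => ⟪v x, Ψ (R⁻¹ • x)⟫_ℝ) μ := by
    refine Eventually.of_forall fun R => Continuous.aestronglyMeasurable ?_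
    exact hvc.inner (hΨc.comp (continuous_id.const_smul R⁻¹))
  have hbound : ∀ᶠ R : ℝ in atTop, ∀ᵐ x ∂μ, ‖⟪v x, Ψ (R⁻¹ • x)⟫_ℝ‖ ≤ M * C := by
    refine Eventually.of_forall fun R => Eventually.of_forall fun x => ?_
    have h1 : ‖⟪v x, Ψ (R⁻¹ • x)⟫_ℝ‖ ≤ ‖v x‖ * ‖Ψ (R⁻¹ • x)‖ := norm_inner_le_norm (v x) (Ψ (R⁻¹ • x))
    have h2 : ‖v x‖ * ‖Ψ (R⁻¹ • x)‖ ≤ M * C := by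
      rw [hM x]
      exact mul_le_mul_of_nonneg_left (hC _) (by rw [← hM x]; exact norm_nonneg _)
    exact h1.trans h2
  have hlim : ∀ᵐ x ∂μ, Tendsto (fun R : ℝ => ⟪v x, Ψ (R⁻¹ • x)⟫_ℝ) atTop (𝓝 ⟪v x, Ψ 0⟫_ℝ) := by
    refine Eventually.of_forall fun x => ?_
    have h0 : Tendsto (fun R : ℝ => R⁻¹ • x) atTop (𝓝 (0 : E3)) := by
      have h := (tendsto_inv_atTop_zero (𝕜 := ℝ)).smul_const x
      rwa [zero_smul] at h
    have hc : Continuous fun y : E3 => ⟪v x, Ψ y⟫_ℝ := continuous_const.inner hΨc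
    exact (hc.tendsto 0).comp h0
  exact tendsto_integral_filter_of_dominated_convergence (fun _ => M * C) hmeas hbound (integrable_const _) hlim

/-! ## The blow-down pairing law -/

/-- **Blow-down pairing law.**  Let `v` be smooth with `‖v‖ ≡ M`, `D¹v, D²v ∈ L²`, and let `μ` be a finite measure with
`S·J₁(φ) − κ⋆²M²(W a₁(φ) + Z c₁(φ)) = ∫⟪v, φ⟫dμ` for every smooth compactly supported divergence-free `φ` (g3's
`exists_multiplierMeasure`).  Then for every smooth compactly supported divergence-free `Ψ`:
**`κ⋆²M²W · a₁(Ψ(R⁻¹·)) → −∫⟪v x, Ψ 0⟫dμ(x)`** as `R → ∞`. [folklore] -/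
theorem tendsto_blowDown_pairing (hv : ContDiff ℝ ∞ v) {M : ℝ} (hM : ∀ x, ‖v x‖ = M)
    (h1 : ∫⁻ x, ‖iteratedFDeriv ℝ 1 v x‖ₑ ^ 2 < ⊤) (h2 : ∫⁻ x, ‖iteratedFDeriv ℝ 2 v x‖ₑ ^ 2 < ⊤)
    (μ : Measure E3) [IsFiniteMeasure μ]
    (hμ : ∀ φ : E3 → E3, ContDiff ℝ ∞ φ → HasCompactSupport φ → VectorCalculus.IsDivFree φ →
      Jst v * J1 v φ - kStar ^ 2 * M ^ 2 * (Wpa v * A1 v φ + Zen v * C1 v φ) = ∫ x, ⟪v x, φ x⟫_ℝ ∂μ)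
    (hΨ : ContDiff ℝ ∞ Ψ) (hΨc : HasCompactSupport Ψ) (hΨdiv : VectorCalculus.IsDivFree Ψ) :
    Tendsto (fun R : ℝ => kStar ^ 2 * M ^ 2 * Wpa v * A1 v (fun y => Ψ (R⁻¹ • y))) atTop
      (𝓝 (-∫ x, ⟪v x, Ψ 0⟫_ℝ ∂μ)) := by
  -- names
  set K : ℝ := kStar with hK
  set Z : ℝ := Zen v with hZ
  set W : ℝ := Wpa v with hW
  set S : ℝ := Jst v with hS
  have hZ0 : 0 ≤ Z := integral_nonneg fun x => sq_nonneg _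
  have hW0 : 0 ≤ W := integral_nonneg fun x => frobeniusNormSq_nonneg _
  -- integrability of the three global densities
  have IZ : Integrable (fun x => ‖curl v x‖ ^ 2) volume := (integrable_norm_curl_sq (hv.of_le (by norm_cast)) h1).1
  have IW : Integrable (fun x => frobeniusNormSq (fderiv ℝ (curl v) x)) volume :=
    (integrable_frobeniusNormSq_fderiv_curl (hv.of_le (by norm_cast)) h2).1
  have ID : Integrable (fun x => ‖fderiv ℝ v x‖ ^ 2) volume := by
    have h1' : ∫⁻ x, ‖fderiv ℝ v x‖ₑ ^ 2 < ⊤ := by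
      refine lt_of_le_of_lt (le_of_eq (lintegral_congr fun x => ?_)) h1
      rw [← ofReal_norm, ← ofReal_norm, norm_iteratedFDeriv_one]
    exact integrable_sq_norm_of_lintegral_lt_top (hv.continuous_fderiv (by simp)) h1'
  -- profile constants
  obtain ⟨CΨ, hC0, hΨb, hcurlb, hDb, hDcurlb⟩ := exists_bounds_of_profile (hΨ.of_le (by norm_cast)) hΨc
  have hDcurlc : HasCompactSupport (fderiv ℝ (curl Ψ)) := by
    have hD : HasCompactSupport (fderiv ℝ Ψ) := hΨc.fderiv (𝕜 := ℝ)
    have hcurl : HasCompactSupport (curl Ψ) := by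
      rw [curl_eq_curlCLM_comp]; exact hD.comp_left (map_zero _)
    exact hcurl.fderiv (𝕜 := ℝ)
  obtain ⟨r, hr⟩ := (Metric.isBounded_iff_subset_closedBall (0 : E3)).1 hDcurlc.isBounded
  set r₁ : ℝ := max r 1 with hr₁
  have hr₁pos : 0 < r₁ := lt_of_lt_of_le one_pos (le_max_right _ _)
  have hsupp : tsupport (fderiv ℝ (curl Ψ)) ⊆ closedBall 0 r₁ := hr.trans (closedBall_subset_closedBall (le_max_left _ _))
  set v₁ : ℝ := (volume (ball (0 : E3) 1)).toReal with hv₁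
  have hv₁0 : 0 ≤ v₁ := ENNReal.toReal_nonneg
  -- the majorant of the `J₁` density
  set g : E3 → ℝ := fun x => CΨ * (‖fderiv ℝ v x‖ ^ 2 + 2 * ‖curl v x‖ ^ 2) with hg
  have hgi : Integrable g volume := (ID.add (IZ.const_mul 2)).const_mul CΨ
  set G : ℝ := ∫ x, g x with hG
  have hG0 : 0 ≤ G := integral_nonneg fun x => by positivity
  have hΨd : Differentiable ℝ Ψ := hΨ.differentiable (by simp)
  have hΨ2 : ContDiff ℝ 2 Ψ := hΨ.of_le (by norm_cast)
  -- the multiplier side: dominated convergence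
  have hμlim := tendsto_integral_inner_rescale hv.continuous hM hΨ.continuous hΨb μ
  rw [Metric.tendsto_atTop] at hμlim ⊢
  intro ε hε
  obtain ⟨Rμ, hRμ⟩ := hμlim (ε / 4) (by positivity)
  -- ε-management for the two small first-variation terms
  set η : ℝ := ε / (2 * (K ^ 2 * M ^ 2 * Z * W + 1)) with hηdef
  have hη : 0 < η := by positivity
  set T : ℝ := |S| * G + K ^ 2 * M ^ 2 * Z * (3 * CΨ ^ 2 * r₁ ^ 3 * v₁ / (2 * η)) with hT
  have hT0 : 0 ≤ T := by positivity
  refine ⟨max (max Rμ 1) (4 * T / ε + 1), fun R hR => ?_⟩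
  have hR1 : 1 ≤ R := (le_max_right _ _).trans ((le_max_left _ _).trans hR)
  have hRpos : 0 < R := lt_of_lt_of_le one_pos hR1
  have hRμ' : Rμ ≤ R := (le_max_left _ _).trans ((le_max_left _ _).trans hR)
  have hRT : 4 * T / ε ≤ R := by linarith [(le_max_right _ _).trans hR]
  have hRinv : 0 < R⁻¹ := inv_pos.2 hRpos
  -- the test field `Ψ_R`
  set φ : E3 → E3 := fun y => Ψ (R⁻¹ • y) with hφdef
  have hφ : ContDiff ℝ ∞ φ := contDiff_rescale hΨ R
  have hφc : HasCompactSupport φ := hasCompactSupport_rescale hΨc hRpos.ne'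
  have hφdiv : VectorCalculus.IsDivFree φ := isDivFree_rescale hΨd hΨdiv R
  -- the multiplier identity for `Ψ_R`
  have hid := hμ φ hφ hφc hφdiv
  set Aφ : ℝ := A1 v φ with hAφ
  set Jφ : ℝ := J1 v φ with hJφ
  set Cφ : ℝ := C1 v φ with hCφ
  -- bound on `J₁(Ψ_R)`
  have hJ : |Jφ| ≤ G / R := by
    rw [hJφ]
    unfold J1
    have hptw : ∀ x, |⟪curl φ x, fderiv ℝ v x (curl v x)⟫ + ⟪curl v x, fderiv ℝ φ x (curl v x)⟫ +
        ⟪curl v x, fderiv ℝ v x (curl φ x)⟫| ≤ g x / R := by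
      intro x
      have hcφ : ‖curl φ x‖ ≤ R⁻¹ * CΨ := by
        rw [hφdef, curl_rescale hΨd, norm_smul, Real.norm_eq_abs, abs_of_pos hRinv]
        exact mul_le_mul_of_nonneg_left (hcurlb _) hRinv.le
      have hDφ : ‖fderiv ℝ φ x‖ ≤ R⁻¹ * CΨ := by
        rw [hφdef, fderiv_rescale hΨd, norm_smul, Real.norm_eq_abs, abs_of_pos hRinv]
        exact mul_le_mul_of_nonneg_left (hDb _) hRinv.le
      set a := ‖fderiv ℝ v x‖ with ha_def
      set b := ‖curl v x‖ with hb_def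
      have ha : 0 ≤ a := norm_nonneg _
      have hb : 0 ≤ b := norm_nonneg _
      have t1 : |⟪curl φ x, fderiv ℝ v x (curl v x)⟫| ≤ R⁻¹ * CΨ * (a * b) := by
        refine (abs_real_inner_le_norm _ _).trans ?_
        exact mul_le_mul hcφ ((fderiv ℝ v x).le_opNorm _) (norm_nonneg _) (by positivity)
      have t2 : |⟪curl v x, fderiv ℝ φ x (curl v x)⟫| ≤ R⁻¹ * CΨ * (b * b) := by
        refine (abs_real_inner_le_norm _ _).trans ?_
        calc ‖curl v x‖ * ‖fderiv ℝ φ x (curl v x)‖ ≤ b * ((R⁻¹ * CΨ) * b) :=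
              mul_le_mul_of_nonneg_left (((fderiv ℝ φ x).le_opNorm _).trans (mul_le_mul_of_nonneg_right hDφ hb)) hb
          _ = R⁻¹ * CΨ * (b * b) := by ring
      have t3 : |⟪curl v x, fderiv ℝ v x (curl φ x)⟫| ≤ R⁻¹ * CΨ * (a * b) := by
        refine (abs_real_inner_le_norm _ _).trans ?_
        calc ‖curl v x‖ * ‖fderiv ℝ v x (curl φ x)‖ ≤ b * (a * (R⁻¹ * CΨ)) :=
              mul_le_mul_of_nonneg_left (((fderiv ℝ v x).le_opNorm _).trans (mul_le_mul_of_nonneg_left hcφ ha)) hb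
          _ = R⁻¹ * CΨ * (a * b) := by ring
      have hsum := (abs_add_le _ _).trans (add_le_add ((abs_add_le _ _).trans (add_le_add t1 t2)) t3)
      have hab : 2 * (a * b) + b ^ 2 ≤ a ^ 2 + 2 * b ^ 2 := by
        have := two_mul_le_add_sq a b
        linarith only [this]
      calc |⟪curl φ x, fderiv ℝ v x (curl v x)⟫ + ⟪curl v x, fderiv ℝ φ x (curl v x)⟫ + ⟪curl v x, fderiv ℝ v x (curl φ x)⟫|
          ≤ R⁻¹ * CΨ * (a * b) + R⁻¹ * CΨ * (b * b) + R⁻¹ * CΨ * (a * b) := hsum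
        _ = R⁻¹ * CΨ * (2 * (a * b) + b ^ 2) := by ring
        _ ≤ R⁻¹ * CΨ * (a ^ 2 + 2 * b ^ 2) := mul_le_mul_of_nonneg_left hab (mul_nonneg hRinv.le hC0)
        _ = g x / R := by rw [hg, ha_def, hb_def, div_eq_inv_mul]; ring
    refine (abs_integral_le_integral_abs).trans ?_
    have hgi' : Integrable (fun x => g x / R) volume := hgi.div_const R
    calc (∫ x, |⟪curl φ x, fderiv ℝ v x (curl v x)⟫ + ⟪curl v x, fderiv ℝ φ x (curl v x)⟫ + ⟪curl v x, fderiv ℝ v x (curl φ x)⟫|)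
        ≤ ∫ x, g x / R := integral_mono_of_nonneg (Eventually.of_forall fun x => abs_nonneg _) hgi'
            (Eventually.of_forall hptw)
      _ = G / R := by rw [integral_div]
  -- bound on `c₁(Ψ_R)`
  have hCb : |Cφ| ≤ η / 2 * W + 3 * CΨ ^ 2 * r₁ ^ 3 * v₁ / (2 * η) / R := by
    rw [hCφ]
    unfold C1
    set ind : E3 → ℝ := (closedBall (0 : E3) (R * r₁)).indicator fun _ => (1 : ℝ) with hind
    have hptw : ∀ x, |∑ i, ⟪fderiv ℝ (curl v) x (EuclideanSpace.basisFun (Fin 3) ℝ i),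
        fderiv ℝ (curl φ) x (EuclideanSpace.basisFun (Fin 3) ℝ i)⟫| ≤
        η / 2 * frobeniusNormSq (fderiv ℝ (curl v) x) + 1 / (2 * η) * (3 * (R⁻¹ * (R⁻¹ * CΨ)) ^ 2 * ind x) := by
      intro x
      have hη' : 0 ≤ 1 / (2 * η) := by rw [one_div]; exact (inv_pos.2 (by linarith only [hη])).le
      refine (sum_inner_le_frobeniusNormSq (fderiv ℝ (curl v) x) (fderiv ℝ (curl φ) x) hη).trans
        (add_le_add le_rfl (mul_le_mul_of_nonneg_left ?_ hη'))
      refine (BradshawTsai2017.frobeniusNormSq_le_three_mul_norm_sq _).trans ?_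
      rw [hφdef, fderiv_curl_rescale hΨ2, norm_smul, norm_smul, Real.norm_eq_abs, abs_of_pos hRinv]
      by_cases hx : x ∈ closedBall (0 : E3) (R * r₁)
      · rw [hind, indicator_of_mem hx, mul_one]
        have h0 : 0 ≤ R⁻¹ * (R⁻¹ * ‖fderiv ℝ (curl Ψ) (R⁻¹ • x)‖) :=
          mul_nonneg hRinv.le (mul_nonneg hRinv.le (norm_nonneg _))
        have : R⁻¹ * (R⁻¹ * ‖fderiv ℝ (curl Ψ) (R⁻¹ • x)‖) ≤ R⁻¹ * (R⁻¹ * CΨ) :=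
          mul_le_mul_of_nonneg_left (mul_le_mul_of_nonneg_left (hDcurlb _) hRinv.le) hRinv.le
        exact mul_le_mul_of_nonneg_left (pow_le_pow_left₀ h0 this 2) (by norm_num)
      · have hy : R⁻¹ • x ∉ tsupport (fderiv ℝ (curl Ψ)) := by
          intro hmem
          have := hsupp hmem
          rw [mem_closedBall, dist_zero_right, norm_smul, Real.norm_eq_abs, abs_of_pos hRinv] at this
          apply hx
          rw [mem_closedBall, dist_zero_right]
          have := mul_le_mul_of_nonneg_left this hRpos.le
          rwa [← mul_assoc, mul_inv_cancel₀ hRpos.ne', one_mul] at this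
        have hind0 : ind x = 0 := by rw [hind, indicator_of_notMem hx]
        rw [image_eq_zero_of_notMem_tsupport hy, norm_zero, mul_zero, mul_zero, hind0, mul_zero]
        norm_num
    have hvol : (volume (closedBall (0 : E3) (R * r₁))).toReal = (R * r₁) ^ 3 * v₁ := by
      rw [Measure.addHaar_closedBall volume (0 : E3) (by positivity : (0 : ℝ) ≤ R * r₁),
        finrank_euclideanSpace, Fintype.card_fin, ENNReal.toReal_mul, ENNReal.toReal_ofReal (by positivity)]
    have hind_int : Integrable ind volume := by
      rw [hind, integrable_indicator_iff measurableSet_closedBall]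
      exact integrableOn_const measure_closedBall_lt_top.ne
    have hmaj_int : Integrable (fun x => η / 2 * frobeniusNormSq (fderiv ℝ (curl v) x) +
        1 / (2 * η) * (3 * (R⁻¹ * (R⁻¹ * CΨ)) ^ 2 * ind x)) volume :=
      (IW.const_mul _).add ((hind_int.const_mul _).const_mul _)
    refine (abs_integral_le_integral_abs).trans ((integral_mono_of_nonneg (Eventually.of_forall fun x => abs_nonneg _)
      hmaj_int (Eventually.of_forall hptw)).trans (le_of_eq ?_))
    rw [integral_add (IW.const_mul _) ((hind_int.const_mul _).const_mul _), integral_const_mul, integral_const_mul,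
      integral_const_mul, hind, integral_indicator measurableSet_closedBall, setIntegral_const, smul_eq_mul, mul_one,
      Measure.real, hvol]
    have hWdef : (∫ a, frobeniusNormSq (fderiv ℝ (curl v) a)) = W := by rw [hW]; rfl
    rw [hWdef]
    field_simp
  -- the multiplier term
  have hμR : |(∫ x, ⟪v x, φ x⟫_ℝ ∂μ) - ∫ x, ⟪v x, Ψ 0⟫_ℝ ∂μ| < ε / 4 := by
    have h := hRμ R hRμ'
    rwa [Real.dist_eq] at h
  -- assemble: `K²M²W·A1 = S·J1 − K²M²Z·C1 − ∫⟪v,φ⟫dμ`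
  have hmain : K ^ 2 * M ^ 2 * W * Aφ = S * Jφ - K ^ 2 * M ^ 2 * Z * Cφ - ∫ x, ⟪v x, φ x⟫_ℝ ∂μ := by
    rw [hAφ, hJφ, hCφ]; linarith [hid]
  have hJterm : |S * Jφ| ≤ |S| * G / R := by
    rw [abs_mul]
    have := mul_le_mul_of_nonneg_left hJ (abs_nonneg S)
    have e : |S| * (G / R) = |S| * G / R := by ring
    linarith only [this, e]
  have hKMZ : 0 ≤ K ^ 2 * M ^ 2 * Z := by positivity
  have hCterm : |K ^ 2 * M ^ 2 * Z * Cφ| ≤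
      K ^ 2 * M ^ 2 * Z * (η / 2 * W) + K ^ 2 * M ^ 2 * Z * (3 * CΨ ^ 2 * r₁ ^ 3 * v₁ / (2 * η)) / R := by
    rw [abs_mul, abs_of_nonneg hKMZ]
    have := mul_le_mul_of_nonneg_left hCb hKMZ
    have e : K ^ 2 * M ^ 2 * Z * (η / 2 * W + 3 * CΨ ^ 2 * r₁ ^ 3 * v₁ / (2 * η) / R) =
        K ^ 2 * M ^ 2 * Z * (η / 2 * W) + K ^ 2 * M ^ 2 * Z * (3 * CΨ ^ 2 * r₁ ^ 3 * v₁ / (2 * η)) / R := by ring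
    linarith only [this, e]
  have hP2 : 0 ≤ K ^ 2 * M ^ 2 * Z * W := by positivity
  have hε2 : K ^ 2 * M ^ 2 * Z * (η / 2 * W) ≤ ε / 4 := by
    have e : K ^ 2 * M ^ 2 * Z * (η / 2 * W) = (K ^ 2 * M ^ 2 * Z * W) * ε / (4 * (K ^ 2 * M ^ 2 * Z * W + 1)) := by
      rw [hηdef]; field_simp; ring
    rw [e, div_le_div_iff₀ (by positivity) (by positivity)]
    nlinarith only [hP2, hε.le]
  have hε3 : |S| * G / R + K ^ 2 * M ^ 2 * Z * (3 * CΨ ^ 2 * r₁ ^ 3 * v₁ / (2 * η)) / R ≤ ε / 4 := by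
    rw [← add_div, ← hT, div_le_iff₀ hRpos]
    have h := hRT
    rw [div_le_iff₀ hε] at h
    linarith only [h]
  rw [Real.dist_eq]
  have e : K ^ 2 * M ^ 2 * W * Aφ - -∫ x, ⟪v x, Ψ 0⟫_ℝ ∂μ =
      S * Jφ - K ^ 2 * M ^ 2 * Z * Cφ - ((∫ x, ⟪v x, φ x⟫_ℝ ∂μ) - ∫ x, ⟪v x, Ψ 0⟫_ℝ ∂μ) := by
    rw [hmain]; ring
  rw [e]
  have hfin := (abs_sub _ _).trans (add_le_add ((abs_sub _ _).trans (add_le_add hJterm hCterm)) hμR.le)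
  linarith only [hfin, hε2, hε3, hμR, hε]

/-- **The blow-down pairing law for the residue object** (all inputs discharged by g3's `exists_multiplierMeasure`).  For a
smooth divergence-free `v` with `‖v‖ ≡ M > 0`, `‖Dv‖ ≤ B`, `D¹v, D²v ∈ L²`, extremal (`|S| = κ⋆M√Z√W`): there is a finite
measure `μ` (mass `≤ κ⋆²ZW`, the KKT multiplier) with barycentre `b = ∫ v dμ` such that for every smooth compactly supported
divergence-free `Ψ`: **`κ⋆²M²W · a₁(Ψ(R⁻¹·)) → −⟪Ψ(0), b⟫`** — the far field of `v − c`, blown down at degree `−1`, is the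
Stokeslet of force `b/(κ⋆²M²W)` in the distributional sense. [folklore] -/
theorem residue_blowDown_pairing (hv : ContDiff ℝ ∞ v) (hdiv : VectorCalculus.IsDivFree v) {M B : ℝ}
    (hMpos : 0 < M) (hM : ∀ x, ‖v x‖ = M) (hB : ∀ x, ‖fderiv ℝ v x‖ ≤ B)
    (h1 : ∫⁻ x, ‖iteratedFDeriv ℝ 1 v x‖ₑ ^ 2 < ⊤) (h2 : ∫⁻ x, ‖iteratedFDeriv ℝ 2 v x‖ₑ ^ 2 < ⊤)
    (hatt : |Jst v| = kStar * M * Real.sqrt (Zen v) * Real.sqrt (Wpa v)) :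
    ∃ μ : Measure E3, IsFiniteMeasure μ ∧ μ univ ≤ ENNReal.ofReal (kStar ^ 2 * Zen v * Wpa v) ∧
      (∀ φ : E3 → E3, ContDiff ℝ ∞ φ → HasCompactSupport φ → VectorCalculus.IsDivFree φ →
        Jst v * J1 v φ - kStar ^ 2 * M ^ 2 * (Wpa v * A1 v φ + Zen v * C1 v φ) = ∫ x, ⟪v x, φ x⟫_ℝ ∂μ) ∧
      ∀ Ψ : E3 → E3, ContDiff ℝ ∞ Ψ → HasCompactSupport Ψ → VectorCalculus.IsDivFree Ψ →
        Tendsto (fun R : ℝ => kStar ^ 2 * M ^ 2 * Wpa v * A1 v (fun y => Ψ (R⁻¹ • y))) atTop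
          (𝓝 (-⟪Ψ 0, ∫ x, v x ∂μ⟫_ℝ)) := by
  obtain ⟨μ, hfin, hmass, hμ⟩ := exists_multiplierMeasure hv hdiv hMpos hM hB h1 h2 hatt
  haveI := hfin
  refine ⟨μ, hfin, hmass, hμ, fun Ψ hΨ hΨc hΨdiv => ?_⟩
  have hvi : Integrable v μ :=
    (integrable_const M).mono' hv.continuous.aestronglyMeasurable (Eventually.of_forall fun x => (hM x).le)
  have e : (∫ x, ⟪v x, Ψ 0⟫_ℝ ∂μ) = ⟪Ψ 0, ∫ x, v x ∂μ⟫_ℝ := by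
    rw [← integral_inner hvi]
    exact integral_congr_ae (Eventually.of_forall fun x => real_inner_comm _ _)
  rw [← e]
  exact tendsto_blowDown_pairing hv hM h1 h2 μ hμ hΨ hΨc hΨdiv

end ExtremiserLiouville

end Summit.NavierStokesRegularity.NavierStokesRegularity.Theorems

end
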